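import Mathlib
import HarnessLib
import HarnessLib.Audit
import Summits.RiemannHypothesis.Statement
import Literature.NumberTheory.LFunctions.RiemannXi
import Literature.NumberTheory.LFunctions.RiemannXiProofs
import Literature.NumberTheory.LFunctions.DeBruijnNewman
import Literature.Analysis.Complex.Hurwitz
import HarnessLib.Audit.Status.Attr

/-!
Route: DisplacementPencil

DORMANT since 2026-08-24T07:10:04Z (reconciler: no traction for 6.6 d (last activity statement-closed at 2026-08-17T16:45:13Z); parked, not closed — `ledger route dormant route-RiemannHypothesis-DisplacementPencil --off` to reactivate) — unstaffed, not closed; items shared with open routes are served there. `ledger route dormant <id> --off` reactivates.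

# Route DisplacementPencil — de Bruijn's differenced xi plus c·xi: a pencil ladder with a proved
foot and finite rungs

DISPLACEMENT PENCIL. For c ≥ 0 put P_c(z) := c·Ξ(z) + Ξ(z+i) + Ξ(z−i) = (c + 2cos D)Ξ, i.e. in the
s-variable
H_c(s) = c·ξ(s) + ξ(s+1) + ξ(s−1); on the kernel side P_c is the cosine transform of (c + 2cosh
u)Φ(u). The foot
P_0 = Ξ(·+i)+Ξ(·−i) has ONLY REAL ZEROS unconditionally (de Bruijn 1950, displacement 1 ≥ strip
half-width 1/2;
Taylor 1945; Lagarias 2005 Thm 2.1), and so does P_c for 0 ≤ c ≤ 2 (symbol c + 2cos z Laguerre–Pólya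
= two real
half-displacements); P_c/c → Ξ locally uniformly as c → ∞, so by Hurwitz RH follows from: X = "P_c
is hyperbolic
(only real zeros) for an unbounded set of c". The route files X in CERTIFICATE SHAPE: a finite base
rung (PencilBase:
P_4 hyperbolic — decidable by an explicit dominance height plus a certified box) and an inductive
step
(PencilDoubling: a hyperbolic rung c ≥ 4 has a hyperbolic rung ≥ 2c). X = PencilBase ∧
PencilDoubling (⇒ rungs
c_k ≥ 4·2^k). Every rung is finitely decidable: above height T(c) = O((c log c)³) the displaced
terms dominate
c·Ξ (explicit bound |ζ(1/2+it)| ≤ 0.618 t^{1/6} log t) and the zeros are those of a monotone-phase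
comb, real.
Lean: `(Literature.NumberTheory.LFunctions.HasOnlyRealZeros (fun z : ℂ => (4 : ℂ) *
Literature.NumberTheory.LFunctions.riemannXiUpper z +
Literature.NumberTheory.LFunctions.riemannXiUpper (z + Complex.I) +
Literature.NumberTheory.LFunctions.riemannXiUpper (z - Complex.I))) ∧ (∀ c : ℝ, 4 ≤ c →
Literature.NumberTheory.LFunctions.HasOnlyRealZeros (fun z : ℂ => (c : ℂ) *
Literature.NumberTheory.LFunctions.riemannXiUpper z +
Literature.NumberTheory.LFunctions.riemannXiUpper (z + Complex.I) +
Literature.NumberTheory.LFunctions.riemannXiUpper (z - Complex.I)) → ∃ c' : ℝ, 2 * c ≤ c' ∧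
Literature.NumberTheory.LFunctions.HasOnlyRealZeros (fun z : ℂ => (c' : ℂ) *
Literature.NumberTheory.LFunctions.riemannXiUpper z +
Literature.NumberTheory.LFunctions.riemannXiUpper (z + Complex.I) +
Literature.NumberTheory.LFunctions.riemannXiUpper (z - Complex.I)))`

## Assembly
Pure logic plus the tree's Hurwitz theorem: from PencilBase and PencilDoubling build
(Classical.choice) a sequence of
hyperbolic rungs c_0 = 4, c_{k+1} ≥ 2c_k, so c_k ≥ 4·2^k; HurwitzTransfer (proved inline in
`closes`) gives
HasOnlyRealZeros Ξ; `riemannHypothesis_iff_im_eq_zero_of_riemannXiUpper_eq_zero_holds` (tree) and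
`Summit.RiemannHypothesis_iff` give the summit. glue.lean = the `closes` of Sketch.lean (lean check
rc 0, axioms
propext / Classical.choice / Quot.sound).

Rationale: WHY THIS LINE. Operator-D (computational-witness) line. The one-parameter family c ↦ P_c joins a
PROVED real-rooted function (c = 0,
de Bruijn's strip theorem [Bruijn1950; BrandenChasse2017 Thm 1.6; Lagarias2005 Thm 2.1; Taylor1945])
to Ξ (c = ∞) and is
NOT a universal factor for c > 2 (the symbol c + 2cos z has the non-real zeros π(2k+1) ±
i·arccosh(c/2)), so Newman's
no-margin theorem (Λ ≥ 0 [RodgersTao2020], heat semigroup) and the tree's universal-factor negatives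
(LaplaceLoophole)
do not price it; unlike the pure shift/cosh rays it is not abscissa-tautological: H_c = E_c + E_c^#
with
E_c(s) = ξ(s+1) + (c/2)ξ(s), and E_c vanishes in Re s > 1/2 for c > 2, so the zeros are not level
crossings of a
monotone phase. New input (kit job j020899, this unit): in Riemann–Siegel coordinates P_c ∝
R(t)cos(θ(t)+χ) +
a(t)[Z(t)/2 − cos θ(t)] with a ≍ c(2π/t)^{1/2}; across the whole crossover band t ∈ [0.07c², 30c²],
where both
terms are comparable, P_c for c = 4, 8, 12 shows NO wrong-sign extremum and sign-change counts equal
to the zero count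
(813/813.0, 1985/1984.8, 3783/3784.4), while the anti-phased control c·Ξ + 2Re(e^{3πi/4}Ξ(·−i))
fails exactly there
(15/141/359 wrong-sign extrema) — a "band protection" phenomenon for the natural pencil; job j021263
extends it to
c = 16, 24, 32 (7490/7490.0, 19058/19055.9, 30320–30324/30324.2 sign changes, 0 wrong-sign extrema,
shallowest
normalised lobe in the band octiles 0.29–0.39 / 0.26–0.40 / 0.20–0.34) — i.e. the ladder 4·2^k is
numerically clean
for k ≤ 3 — and shows the SAME protection for Pólya's fake Ξ* (kernel 8π²cosh(9u/2)e^{−2π cosh 2u},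
real zeros by
Pólya 1926, no arithmetic): the mechanism is analytic (kernel class), not arithmetic. What is
imported: de Bruijn–
Pólya strip technology (complex analysis), explicit estimates for ζ on the critical line
[HiaryPatelYang2024] and
certified zero counting à la Platt–Trudgian [PlattTrudgian2021] (computation), Hurwitz (tree). No
prior route
deforms from a proved rung at FINITE parameter with POLYNOMIAL box heights (DBN: heat, boxes X(t) ~
exp(C/t),
margin-free at t = 0; EarlyAppointments: derivative clock, far end unproved; Strip:
displacement-as-abscissa).

RANKED CRUXES. #0 PencilUnbounded (target) — X in one line: the displacement pencil is hyperbolic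
for an unbounded set of weights c (this is what the base and the doubling step produce; it implies
RH by the route's Hurwitz transfer). (why it might fail: it implies RH (Hurwitz); a hypothetical
off-line pair of Ξ at height t* forces non-real zeros of P_c for all c ≳ √t* (births at the band
edge), so failure is invisible below c ~ 10^6.) [Bruijn1950, Lagarias2005, kit:j020899]
#2 PencilDoubling (crux) — DOUBLING STEP. For every c ≥ 4: if P_c = c·Ξ + Ξ(·+i) + Ξ(·−i) has only
real zeros, then some P_{c'} with c' ≥ 2c has only real zeros. One instance is a statement about two
rungs of one explicit family whose zeros above height T(2c) = O((c log c)³) are provably real, so it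
concerns the bounded box |Re z| ≤ T(2c): the low region (|Re z| < c², where c·Ξ dominates and the
zeros of both rungs are pinned to the same zeros of Ξ) and the crossover band [c², T(2c)] (mixture
of Z with its de Bruijn-regularised companion). [difficulty: open-problem] (why it might fail: the
band (30c², 120c²] of the rung 2c is fresh territory: a Gram-block configuration of Z there could
cost the mixture a sign change; hyperbolicity at c gives no direct control at 2c; numerics (double
precision) cover the doublings 4→8→16→32 only, with band margins thinning slowly (0.29 → 0.20).)
[Lagarias2005, Bruijn1950, BrandenChasse2017, Trudgian2011, CsordasSmithVarga1994, kit:j020899,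
kit:j021263]
#3 PencilBase (crux) — BASE RUNG (certificate). P_4 = 4Ξ + Ξ(·+i) + Ξ(·−i) has only real zeros.
Decidable: (i) explicit dominance — for |Re z| ≥ 3·10^7 the displaced terms beat 4·Ξ at every
carrier extremum (|ζ(1/2+it)| ≤ 0.618 t^{1/6} log t against (t/2π)^{1/2} ζ(3)/ζ(3/2) from
|ξ(3/2+it)/ξ(1/2+it)|) and the phase of Ξ(t−i) is strictly monotone, so those zeros are real and
simple; (ii) a certified count in the box |Re z| < 3·10^7 (sign changes of the real function P_4(t)
against the argument-principle count; Riemann–Siegel for ζ at σ = 1/2 and 3/2 in ball arithmetic,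
~3·10^8 grid points). [difficulty: L] (why it might fail: a non-real pair of P_4 anywhere below
3·10^7 (the scans j020899/j021263 are double-precision mpmath, c = 4 to height 1200 and c = 8…32 to
25–30c²; a close pair below the grid step or a failure in (1200, 3·10^7) would be missed); or the
dominance constant leaves a gap above the certified box.) [HiaryPatelYang2024, PlattTrudgian2021,
Bruijn1950, kit:j020899]
#9 HurwitzTransfer (support) — If P_{c_k} has only real zeros along a sequence c_k ≥ 4·2^k then Ξ
has only real zeros (P_{c_k}/c_k → Ξ locally uniformly; the rungs are zero-free off the axis;
Hurwitz; Ξ(i/2) = ξ(0) = 1/2 ≠ 0). PROVED in Sketch.lean / inside `closes` from the tree's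
`Complex.hurwitz_eqOn_zero_or_forall_ne_zero`. [difficulty: provable-now] [Conway1978,
lean:Literature/Analysis/Complex/Hurwitz.lean]
#9 HighReal (support) — EXPLICIT DOMINANCE (the provable far region of every rung): there is A such
that for every c ≥ 1 all zeros of P_c with |Re z| ≥ A·c^4 are real. (Sharper: T(c) = O((c log c)^3)
with the t^{1/6} bound; c^4 suffices with the convexity bound.) Helps both cruxes. [difficulty: M]
[HiaryPatelYang2024, Titchmarsh1986, Bruijn1950, Lagarias2005]
#9 SmallWeightsReal (support) — PROVED FOOT OF THE LADDER: for 0 ≤ c ≤ 2, P_c has only real zeros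
unconditionally (c + 2cos z = 4cos((z+α)/2)cos((z−α)/2), c = 2cos α: two displacements by 1/2 ≥ the
half-width 1/2 of the closed strip containing the zeros of Ξ; de Bruijn's Thm 3/Lemma 1 with Δ =
1/2, λ = 1/2 and Thm 6, then Hurwitz as in `rootsInStrip_of_tendstoLocallyUniformly`). [difficulty:
M] [Bruijn1950, BrandenChasse2017, Lagarias2005, Taylor1945,
lean:Literature/Analysis/Complex/DeBruijnUniversalFactors.lean]
#9 RHImpliesPencil (support) — CALIBRATION: under RH every rung c ≥ 0 is hyperbolic (so the ladder
is not stronger than RH). Not automatic for c > 2 (the symbol is not Laguerre–Pólya); the Ξ* control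
of j021263 suggests the analytic form "K even, positive, log-concave, admissible (de Bruijn) with
hyperbolic cosine transform ⇒ the transform of (c + 2cosh u)K is hyperbolic for every c ≥ 0"
(two-bump kernels resonate at c = 2cosh a, so log-concavity is not decoration); a refutation at
finite c would show the ladder is RH-plus and re-price PencilDoubling. [difficulty: open-problem]
[Bruijn1950, Cardon2001, Cardon2004, CsordasNorfolkVarga1986, kit:j020899, kit:j021263]

TWO-LAYER PLAN. Foreseen glued splits (bc/ skeletons, lean-checked): PencilBase ⇐ High4 (zeros with
|Re z| ≥ 3·10^7 real, analytic) →
Box4 (zeros with |Re z| < 3·10^7 real, certified computation) → PencilBase; PencilDoubling ⇐ Low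
(rung 2c below height
c², pinning transfer from rung c) → BandHigh (rung 2c at heights ≥ c²: crossover band + dominance) →
PencilDoubling.

KILL CRITERIA. K1: a certified (ball-arithmetic) non-real zero pair — equivalently a confirmed
wrong-sign extremum or a sign-change
deficit ≥ 2 against the certified box count — of P_4 below 3·10^7 refutes PencilBase: close
refuted:PencilBase (the
finding itself, a protected-phase failure, is filed as evidence on the three-clocks/deformation
census). K2: the same
for P_c at three consecutive doublings c ∈ {2^j, 2^{j+1}, 2^{j+2}} (j ≥ 3) with the failures inside
the crossover
bands retires PencilDoubling (close exhausted with the failure law as census). K3: a proof that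
RHImpliesPencil is
FALSE at some finite c (ladder stronger than RH) forces a pivot to the phase-optimised pencil c·Ξ +
2Re(e^{−iπ/4}Ξ(·−i))
(same numerics, maximal carrier alignment) or retirement. Mooted if DBN lands Λ = 0 or any route
lands RH.

NOT DECOMPOSED YET. The explicit constants of HighReal (Stirling for |ξ(3/2+it)/ξ(1/2+it)|, the
0.618 t^{1/6} log t bound, the carrier-
extremum Rouché argument) and the certified-box protocol (grid, Turing-type count for P_c, ball
radii) are layer-2
children of PencilBase; the zero-flow / continuity-in-c analysis of the band (collisions = double
real zeros; candidate
monotone functional: arg E_c(1/2+it) with E_c = ξ(s+1) + (c/2)ξ(s), or a class-preservation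
statement for kernels
(c + 2cosh u)K with K log-concave and super-exponentially decaying — the Ξ* control points there;
two-bump kernels
show the class must exclude resonances c = 2cosh a) is the content of PencilDoubling and is left to
crux ideation.

CHEAPEST FALSIFIER. (1) One more doubling: scan c = 64 over [10, 30c²] = [10, 1.2·10^5] for
wrong-sign extrema (Riemann–Siegel in C/Arb,
hours; mpmath would take ~40 core-h); (2) an Arb re-run of the c = 4 rung to 10^5 at step 0.01 with
certified lobe
signs; (3) the class counterexample hunt: a log-concave admissible kernel with hyperbolic transform
whose pencil fails
(kills the analytic reading, not the route). Already run: j020899 (623 s) c = 4, 8, 12 clean over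
[10, 30c²] in both
natural phases, anti-phase fails; j021263 (7375 s, 16 cores) c = 16, 24, 32 clean to 30c², 30c²,
25c² (0 wrong-sign
extrema, counts = expected ± 4), band-octile lobe margins ≥ 0.20, anti-phase c = 16 loses 2171 sign
changes, and
Pólya's Ξ* pencil c = 0, 4, 8 clean (analytic mechanism).

NUMBERS. Foot: c = 0 proved (displacement 1 ≥ 1/2: Bruijn1950; Lagarias2005 Thm 2.1 gives simplicity
+ interlacing); 0 ≤ c ≤ 2
provable (LP symbol). Crossover band of rung c: t ∈ [2πc²/ζ(3/2)², 2πc²(ζ(3/2)/ζ(3))²] ≈ [0.92c²,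
29.6c²] (a(t) = 1);
provable dominance from t^{1/3} > 3.37·c·log t (c = 4: t ≳ 1.2·10^7; c = 16: ≈ 1.3·10^9). j020899:
sign changes
vs θ-main term 341/340.7 (c=0), 491/490.6 (c=2), 813/813.0 (c=4), 1985/1984.8 (c=8),
3782–3783/3784.4 (c=12);
wrong-sign extrema 0 in all natural-phase cases; anti-phase 15 (c=4), 141 (c=8), 359 (c=12),
concentrated at
t/c² ∈ [3, 30]. j021263: 7490/7490.0 (c=16, both phases), 19058 & 19060/19055.9 (c=24), 30320 &
30324/30324.2
(c=32), 0 wrong-sign; min normalised lobe by band octile 0.288–0.387 (16), 0.255–0.397 (24),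
0.199–0.339 (32);
anti c=16: 5319/7490 (719 wrong-sign); Ξ* control 340/340.7, 269/269.6, 1470/1471.2 (c = 0, 4, 8), 0
wrong-sign. RH verified to 3·10^12 [PlattTrudgian2021]; Λ ∈ [0, 0.2] [RodgersTao2020, Polymath2019].

DEFINITION REQUESTS. None (the pencil is inlined in every item; a definition item
`displacementPencil c z` under
Literature/NumberTheory/LFunctions would shorten the statements and is requested after open).

Novelty: Searches (2026-08-17): `lit search --hybrid` "differenced L-functions xi(s+h)+xi(s-h) zeros critical
line Lagarias de Bruijn" (hit: BrandenChasse arXiv:1402.2795, READ Thms 1.2/1.6/1.7/1.8 pp. 3–7);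
zbMATH "differenced L-functions zero spacing Lagarias" (1 hit: Lagarias2005 = arXiv:math/0601653,
READ Thm 2.1 p. 6, Remark (3) p. 13, §3 p. 7); zbMATH "zeros linear combination Riemann xi function
shifted arguments critical line" (0); `lit galaxy search --star all` "shifts of the Riemann xi" /
"Matiyasevich finite Dirichlet series" / title "Riemann hypothesis" (0/0/9 books, none relevant);
Titchmarsh1986 READ pp. 29, 204, 297 (Taylor (1), Pólya's Ξ*); the 22 open + 9 closed routes and the
closed cards deformation-no-go, three-clocks-debruijn-cone, sinh-ray-fold-depth,
displacement-law-near-line (READ); `ledger negatives` (1 entry, LaplaceLoophole).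
Nearest prior art found: Lagarias2005 (A_h = (ξ(s+h)+ξ(s−h))/2 critical-rooted for |h| ≥ 1/2, all h
under RH; Remark (3) asks the INVERSE question whether ξ can be an average of shifts of a
critical-rooted G — expected not, by GUE); Bruijn1950 / BrandenChasse2017 (strip-narrowing
operators: cos(λD), e^{−λD²}, Thm 1.8 family — all with Laguerre–Pólya-type symbols); Cardon2001
(convolution operators Σ a_j F(z+iτ_j) preserving real zeros under LP-type hypotheses on the
measure); closed card three-clocks-debruijn-cone (cosh RAYS are abscissa-tautological; LP-sets along
rays can be disconnected); route DBN (heat ladder, Polymath15 finite ru  [refs: 1402.2795, math/0601653, Lagarias2005, Titchmarsh1986, Bruijn1950, BrandenChasse2017, Cardon2001]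

Barriers (technique_class: displacement-pencil, deBruijn-strip-ops, cert-rungs): - technique_class: displacement-pencil, deBruijn-strip-ops, cert-rungs
- Literature.Barriers.RiemannHypothesis.NewmanConjecture: evaded structurally — Λ ≥ 0 prices the
Gaussian semigroup (the only universal real-rooting semigroup); the pencil is not a universal factor
(symbol zeros off the imaginary axis for c > 2) and its rungs give up tracking Ξ above height ~30c²,
so extreme Lehmer pairs at large height (the mechanism of Λ ≥ 0, CsordasSmithVarga1994) are
overwritten by the displaced comb instead of setting the threshold; whether the rungs keep a MARGIN
is exactly what j021263 measures.
- Literature.Barriers.RiemannHypothesis.JensenPolynomials: the analogue of Farmer's "large shift is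
RH-empty" holds here too and is conceded: the region |Re z| ≥ T(c) of every rung is RH-empty
(HighReal); the content sits in the crossover band and, for the deciding power, at the band edge c ~
√t — the route does not claim information from the easy region.
- Literature.Barriers.RiemannHypothesis.GramRosserFailures: it does bite on badly phased pencils
(the anti-phase control loses hundreds of sign changes exactly at Gram-type blocks); the bet,
supported by j020899, is that the natural phases (relative carrier angle π/4 + arg ζ(3/2+it), never
π since |arg ζ(3/2+it)| ≤ log ζ(3/2) = 0.96) are protected; a protected-phase failure at larger c
kills the line (K1/K2).
- Literature.Barriers.RiemannHypothesis.LindelofBacklund: size bounds for ζ are used only where they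
suffice by design (dominance reg

History (route lifecycle, newest last):
- 2026-08-24T07:10:04Z · DORMANT — reconciler: no traction for 6.6 d (last activity statement-closed at 2026-08-17T16:45:13Z); parked, not closed — `ledger route dormant route-RiemannHypothesis-D (operator:999:4078819)

sub-problem: RiemannHypothesis · status: dormant · opened planner-plan-novel-RiemannHypothesis-RiemannHyp-a25c1f69-d-v2-g12-0 2026-08-17T04:49:09Z · rev 0 · ledger route-RiemannHypothesis-DisplacementPencil
GENERATED by the gate from the ledger (D-0016/17). Provers cite these decls: `theorem foo : Summit.RiemannHypothesis.RiemannHypothesis.Theses.DisplacementPencil.<Decl> := …` in Summits/RiemannHypothesis/RiemannHypothesis/Theorems/<Name>.lean.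
-/

namespace Summit.RiemannHypothesis.RiemannHypothesis.Theses.DisplacementPencil

open scoped BigOperators Topology Manifold Classical MeasureTheory ProbabilityTheory Matrix InnerProductSpace ComplexConjugate ContinuousMap
open Filter Set Function TopologicalSpace MeasureTheory

attribute [summit_statement] _root_.Summit.RiemannHypothesis

open Summit

/-- item stmt-RiemannHypothesis-17886 · target · rank 0 · open · by planner
why it might fail: it implies RH (Hurwitz); a hypothetical off-line pair of Ξ at height t* forces non-real zeros of P_c for all c ≳ √t* (births at the band edge), so failure is invisible below c ~ 10^6.
sources: Bruijn1950, Lagarias2005, kit:j020899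
[target] X in one line: the displacement pencil is hyperbolic for an unbounded set of weights c
(this is what the base and the doubling step produce; it implies RH by the route's Hurwitz
transfer). -/
@[route_item "route-RiemannHypothesis-DisplacementPencil"]
def PencilUnbounded : Prop :=
  ∀ C : ℝ, ∃ c : ℝ, C ≤ c ∧ Literature.NumberTheory.LFunctions.HasOnlyRealZeros (fun z : ℂ => (c : ℂ) * Literature.NumberTheory.LFunctions.riemannXiUpper z + Literature.NumberTheory.LFunctions.riemannXiUpper (z + Complex.I) + Literature.NumberTheory.LFunctions.riemannXiUpper (z - Complex.I))

/-- item stmt-RiemannHypothesis-17887 · crux · rank 2 · open · by planner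
why it might fail: the band (30c², 120c²] of the rung 2c is fresh territory: a Gram-block configuration of Z there could cost the mixture a sign change; hyperbolicity at c gives no direct control at 2c; numerics (double precision) cover the doublings 4→8→16→32 only, with band margins thinning slowly (0.29 → 0.20).
sources: Lagarias2005, Bruijn1950, BrandenChasse2017, Trudgian2011, CsordasSmithVarga1994, kit:j020899
[crux] DOUBLING STEP. For every c ≥ 4: if P_c = c·Ξ + Ξ(·+i) + Ξ(·−i) has only real zeros, then some
P_{c'} with c' ≥ 2c has only real zeros. One instance is a statement about two rungs of one explicit
family whose zeros above height T(2c) = O((c log c)³) are provably real, so it concerns the bounded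
box |Re z| ≤ T(2c): the low region (|Re z| < c², where c·Ξ dominates and the zeros of both rungs are
pinned to the same zeros of Ξ) and the crossover band [c², T(2c)] (mixture of Z with its de
Bruijn-regularised companion). [difficulty: open-problem] -/
@[route_item "route-RiemannHypothesis-DisplacementPencil", crux (experiment := "instrument: kit jobs cited as sources kit:j020899, kit:j021263") (source := "ledger wanted_by.sources on stmt-RiemannHypothesis-17887, 2026-09-01")]
def PencilDoubling : Prop :=
  ∀ c : ℝ, 4 ≤ c → Literature.NumberTheory.LFunctions.HasOnlyRealZeros (fun z : ℂ => (c : ℂ) * Literature.NumberTheory.LFunctions.riemannXiUpper z + Literature.NumberTheory.LFunctions.riemannXiUpper (z + Complex.I) + Literature.NumberTheory.LFunctions.riemannXiUpper (z - Complex.I)) → ∃ c' : ℝ, 2 * c ≤ c' ∧ Literature.NumberTheory.LFunctions.HasOnlyRealZeros (fun z : ℂ => (c' : ℂ) * Literature.NumberTheory.LFunctions.riemannXiUpper z + Literature.NumberTheory.LFunctions.riemannXiUpper (z + Complex.I) + Literature.NumberTheory.LFunctions.riemannXiUpper (z - Complex.I))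

/-- item stmt-RiemannHypothesis-17888 · crux · rank 3 · open · by planner
why it might fail: a non-real pair of P_4 anywhere below 3·10^7 (the scans j020899/j021263 are double-precision mpmath, c = 4 to height 1200 and c = 8…32 to 25–30c²; a close pair below the grid step or a failure in (1200, 3·10^7) would be missed); or the dominance constant leaves a gap above the certified box.
sources: HiaryPatelYang2024, PlattTrudgian2021, Bruijn1950, kit:j020899
[crux] BASE RUNG (certificate). P_4 = 4Ξ + Ξ(·+i) + Ξ(·−i) has only real zeros. Decidable: (i)
explicit dominance — for |Re z| ≥ 3·10^7 the displaced terms beat 4·Ξ at every carrier extremum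
(|ζ(1/2+it)| ≤ 0.618 t^{1/6} log t against (t/2π)^{1/2} ζ(3)/ζ(3/2) from |ξ(3/2+it)/ξ(1/2+it)|) and
the phase of Ξ(t−i) is strictly monotone, so those zeros are real and simple; (ii) a certified count
in the box |Re z| < 3·10^7 (sign changes of the real function P_4(t) against the argument-principle
count; Riemann–Siegel for ζ at σ = 1/2 and 3/2 in ball arithmetic, ~3·10^8 grid points).
[difficulty: L] -/
@[route_item "route-RiemannHypothesis-DisplacementPencil", crux (experiment := "instrument: kit jobs cited as sources kit:j020899") (source := "ledger wanted_by.sources on stmt-RiemannHypothesis-17888, 2026-09-01")]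
def PencilBase : Prop :=
  Literature.NumberTheory.LFunctions.HasOnlyRealZeros (fun z : ℂ => (4 : ℂ) * Literature.NumberTheory.LFunctions.riemannXiUpper z + Literature.NumberTheory.LFunctions.riemannXiUpper (z + Complex.I) + Literature.NumberTheory.LFunctions.riemannXiUpper (z - Complex.I))

/-- item stmt-RiemannHypothesis-17889 · support · rank 9 · closed · proved by Summit.RiemannHypothesis.RiemannHypothesis.Theorems.displacementPencil_hurwitzTransfer @ b9c7aa339cd9 (planner) · by planner
sources: Conway1978, lean:Literature/Analysis/Complex/Hurwitz.lean
[support] If P_{c_k} has only real zeros along a sequence c_k ≥ 4·2^k then Ξ has only real zeros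
(P_{c_k}/c_k → Ξ locally uniformly; the rungs are zero-free off the axis; Hurwitz; Ξ(i/2) = ξ(0) =
1/2 ≠ 0). PROVED in Sketch.lean / inside `closes` from the tree's
`Complex.hurwitz_eqOn_zero_or_forall_ne_zero`. [difficulty: provable-now] -/
@[route_item "route-RiemannHypothesis-DisplacementPencil"]
def HurwitzTransfer : Prop :=
  ∀ c : ℕ → ℝ, (∀ k, (4 : ℝ) * 2 ^ k ≤ c k) → (∀ k, Literature.NumberTheory.LFunctions.HasOnlyRealZeros (fun z : ℂ => (c k : ℂ) * Literature.NumberTheory.LFunctions.riemannXiUpper z + Literature.NumberTheory.LFunctions.riemannXiUpper (z + Complex.I) + Literature.NumberTheory.LFunctions.riemannXiUpper (z - Complex.I))) → Literature.NumberTheory.LFunctions.HasOnlyRealZeros Literature.NumberTheory.LFunctions.riemannXiUpper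

/-- item stmt-RiemannHypothesis-17890 · support · rank 9 · open · by planner
sources: HiaryPatelYang2024, Titchmarsh1986, Bruijn1950, Lagarias2005
[support] EXPLICIT DOMINANCE (the provable far region of every rung): there is A such that for every
c ≥ 1 all zeros of P_c with |Re z| ≥ A·c^4 are real. (Sharper: T(c) = O((c log c)^3) with the
t^{1/6} bound; c^4 suffices with the convexity bound.) Helps both cruxes. [difficulty: M] -/
@[route_item "route-RiemannHypothesis-DisplacementPencil"]
def HighReal : Prop :=
  ∃ A : ℝ, ∀ c : ℝ, 1 ≤ c → ∀ z : ℂ, (c : ℂ) * Literature.NumberTheory.LFunctions.riemannXiUpper z + Literature.NumberTheory.LFunctions.riemannXiUpper (z + Complex.I) + Literature.NumberTheory.LFunctions.riemannXiUpper (z - Complex.I) = 0 → A * c ^ 4 ≤ |z.re| → z.im = 0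

/-- item stmt-RiemannHypothesis-17891 · support · rank 9 · open · by planner
sources: Bruijn1950, BrandenChasse2017, Lagarias2005, Taylor1945, lean:Literature/Analysis/Complex/DeBruijnUniversalFactors.lean
[support] PROVED FOOT OF THE LADDER: for 0 ≤ c ≤ 2, P_c has only real zeros unconditionally (c +
2cos z = 4cos((z+α)/2)cos((z−α)/2), c = 2cos α: two displacements by 1/2 ≥ the half-width 1/2 of the
closed strip containing the zeros of Ξ; de Bruijn's Thm 3/Lemma 1 with Δ = 1/2, λ = 1/2 and Thm 6,
then Hurwitz as in `rootsInStrip_of_tendstoLocallyUniformly`). [difficulty: M] -/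
@[route_item "route-RiemannHypothesis-DisplacementPencil"]
def SmallWeightsReal : Prop :=
  ∀ c : ℝ, 0 ≤ c → c ≤ 2 → Literature.NumberTheory.LFunctions.HasOnlyRealZeros (fun z : ℂ => (c : ℂ) * Literature.NumberTheory.LFunctions.riemannXiUpper z + Literature.NumberTheory.LFunctions.riemannXiUpper (z + Complex.I) + Literature.NumberTheory.LFunctions.riemannXiUpper (z - Complex.I))

/-- item stmt-RiemannHypothesis-17892 · support · rank 9 · open · by planner
sources: Bruijn1950, Cardon2001, Cardon2004, CsordasNorfolkVarga1986, kit:j020899, kit:j021263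
[support] CALIBRATION: under RH every rung c ≥ 0 is hyperbolic (so the ladder is not stronger than
RH). Not automatic for c > 2 (the symbol is not Laguerre–Pólya); the Ξ* control of j021263 suggests
the analytic form "K even, positive, log-concave, admissible (de Bruijn) with hyperbolic cosine
transform ⇒ the transform of (c + 2cosh u)K is hyperbolic for every c ≥ 0" (two-bump kernels
resonate at c = 2cosh a, so log-concavity is not decoration); a refutation at finite c would show
the ladder is RH-plus and re-price PencilDoubling. [difficulty: open-problem] -/
@[route_item "route-RiemannHypothesis-DisplacementPencil"]
def RHImpliesPencil : Prop :=
  RiemannHypothesis → ∀ c : ℝ, 0 ≤ c → Literature.NumberTheory.LFunctions.HasOnlyRealZeros (fun z : ℂ => (c : ℂ) * Literature.NumberTheory.LFunctions.riemannXiUpper z + Literature.NumberTheory.LFunctions.riemannXiUpper (z + Complex.I) + Literature.NumberTheory.LFunctions.riemannXiUpper (z - Complex.I))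

/-- item stmt-RiemannHypothesis-17893 · assembly · rank 1 · open · by planner
sources: Conway1978, Bruijn1950
[assembly] PencilBase → PencilDoubling → RH. -/
@[route_item "route-RiemannHypothesis-DisplacementPencil"]
def Assembly : Prop :=
  PencilBase → PencilDoubling → Summit.RiemannHypothesis

/-! D-0027 §2.1 — DECIDING THEOREM (planner-authored via `route open/edit --closes-file`; by planner-plan-novel-RiemannHypothesis-RiemannHyp-a25c1f69-d-v 2026-08-17T04:49:09Z):
its hypotheses are this route's items and its conclusion the sub-problem Statement (glue_lint), and it elaborates with this file. -/

/-- DECIDING THEOREM (D-0027 §2.1) of route DisplacementPencil. From the base rung `PencilBase`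
(c = 4 hyperbolic) and the doubling step `PencilDoubling` we build hyperbolic rungs `c_k ≥ 4·2^k`
(`Classical.choice` along the step); the support item `HurwitzTransfer` is PROVED inline from the
tree's Hurwitz theorem (`Complex.hurwitz_eqOn_zero_or_forall_ne_zero`): `P_{c_k}/c_k → Ξ` locally
uniformly, the rungs are zero-free off the real axis, so a non-real zero of `Ξ` would force `Ξ ≡ 0`,
contradicting `Ξ(i/2) = ξ(0) = 1/2`; Riemann's `Ξ`-form of RH
(`riemannHypothesis_iff_im_eq_zero_of_riemannXiUpper_eq_zero_holds`) and `Summit.RiemannHypothesis_iff`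
give the summit. Axioms: propext, Classical.choice, Quot.sound. -/
@[closes "route-RiemannHypothesis-DisplacementPencil"] theorem closes (hbase : PencilBase) (hstep : PencilDoubling) : _root_.Summit.RiemannHypothesis := by
  classical
  -- (1) the Hurwitz transfer (support item `HurwitzTransfer`), proved here
  have htransfer : HurwitzTransfer := by
    intro c hc hreal z₀ hz₀
    by_contra him
    have hΞd : Differentiable ℂ Literature.NumberTheory.LFunctions.riemannXiUpper := by
      intro z
      unfold Literature.NumberTheory.LFunctions.riemannXiUpper
      have h : Differentiable ℂ (fun z : ℂ => (1 / 2 : ℂ) + Complex.I * z) :=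
        (differentiable_const _).add (differentiable_id.const_mul _)
      exact (Literature.NumberTheory.LFunctions.differentiable_riemannXi.comp h) z
    have hΞval : Literature.NumberTheory.LFunctions.riemannXiUpper (Complex.I / 2) = 1 / 2 := by
      unfold Literature.NumberTheory.LFunctions.riemannXiUpper
      have : (1 / 2 : ℂ) + Complex.I * (Complex.I / 2) = 0 := by
        rw [mul_div_assoc', Complex.I_mul_I]; ring
      rw [this, Literature.NumberTheory.LFunctions.riemannXi_zero]
    set r : ℝ := |z₀.im| / 2 with hr
    have hrpos : 0 < r := by
      have : 0 < |z₀.im| := abs_pos.mpr him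
      positivity
    set U : Set ℂ := Metric.ball z₀ r with hU
    have hUopen : IsOpen U := Metric.isOpen_ball
    have hUconn : IsPreconnected U := (convex_ball z₀ r).isPreconnected
    have hz₀U : z₀ ∈ U := Metric.mem_ball_self hrpos
    have hUim : ∀ z ∈ U, z.im ≠ 0 := by
      intro z hz h0
      have hdist : dist z z₀ < r := Metric.mem_ball.mp hz
      have h1 : |z.im - z₀.im| ≤ dist z z₀ := by
        rw [Complex.dist_eq]
        simpa using Complex.abs_im_le_norm (z - z₀)
      rw [h0, zero_sub, abs_neg] at h1
      have : |z₀.im| < |z₀.im| / 2 := lt_of_le_of_lt h1 hdist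
      linarith [abs_nonneg z₀.im]
    set g : ℂ → ℂ := fun z => Literature.NumberTheory.LFunctions.riemannXiUpper (z + Complex.I) +
      Literature.NumberTheory.LFunctions.riemannXiUpper (z - Complex.I) with hg
    have hgcont : Continuous g := by
      have hΞ := hΞd.continuous
      exact (hΞ.comp (continuous_id.add continuous_const)).add
        (hΞ.comp (continuous_id.sub continuous_const))
    obtain ⟨M, hM⟩ : ∃ M : ℝ, ∀ z ∈ Metric.closedBall z₀ r, ‖g z‖ ≤ M := by
      have hK : IsCompact (Metric.closedBall z₀ r) := isCompact_closedBall _ _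
      obtain ⟨M, hM⟩ := hK.exists_bound_of_continuousOn hgcont.continuousOn
      exact ⟨M, hM⟩
    have hcpos : ∀ k, 0 < c k := fun k => lt_of_lt_of_le (by positivity) (hc k)
    set F : ℕ → ℂ → ℂ := fun k z =>
      Literature.NumberTheory.LFunctions.riemannXiUpper z + (c k : ℂ)⁻¹ * g z with hF
    have hFdiff : ∀ᶠ k in Filter.atTop, DifferentiableOn ℂ (F k) U := by
      refine Filter.Eventually.of_forall fun k => ?_
      have hgd : Differentiable ℂ g :=
        (hΞd.comp (differentiable_id.add (differentiable_const _))).add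
          (hΞd.comp (differentiable_id.sub (differentiable_const _)))
      exact (hΞd.add (hgd.const_mul _)).differentiableOn
    have hunif : TendstoUniformlyOn F Literature.NumberTheory.LFunctions.riemannXiUpper
        Filter.atTop U := by
      rw [Metric.tendstoUniformlyOn_iff]
      intro ε hε
      obtain ⟨k₀, hk₀⟩ : ∃ k₀ : ℕ, M < ε * (4 * 2 ^ k₀) := by
        obtain ⟨k₀, hk₀⟩ := pow_unbounded_of_one_lt (M / (4 * ε) + 1) (by norm_num : (1 : ℝ) < 2)
        refine ⟨k₀, ?_⟩
        have h4ε : 0 < 4 * ε := by positivity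
        have : M / (4 * ε) < 2 ^ k₀ := by linarith
        rw [div_lt_iff₀ h4ε] at this
        linarith
      refine Filter.eventually_atTop.mpr ⟨k₀, fun k hk z hz => ?_⟩
      have hzc : z ∈ Metric.closedBall z₀ r := Metric.ball_subset_closedBall hz
      have hck : (4 : ℝ) * 2 ^ k₀ ≤ c k := le_trans
        (mul_le_mul_of_nonneg_left (pow_le_pow_right₀ (by norm_num) hk) (by norm_num)) (hc k)
      have hckpos : 0 < c k := hcpos k
      rw [dist_eq_norm]
      have : Literature.NumberTheory.LFunctions.riemannXiUpper z - F k z = -((c k : ℂ)⁻¹ * g z) := by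
        simp [hF]
      rw [this, norm_neg, norm_mul, norm_inv, Complex.norm_real, Real.norm_eq_abs,
        abs_of_pos hckpos]
      calc (c k)⁻¹ * ‖g z‖ ≤ (c k)⁻¹ * M := by
              exact mul_le_mul_of_nonneg_left (hM z hzc) (inv_nonneg.mpr hckpos.le)
        _ < ε := by
              rw [inv_mul_lt_iff₀ hckpos]
              calc M < ε * (4 * 2 ^ k₀) := hk₀
                _ ≤ ε * c k := by exact mul_le_mul_of_nonneg_left hck hε.le
                _ = c k * ε := by ring
    have hlim : TendstoLocallyUniformlyOn F Literature.NumberTheory.LFunctions.riemannXiUpper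
        Filter.atTop U := hunif.tendstoLocallyUniformlyOn
    have hzero : ∃ᶠ k in Filter.atTop, ∀ z ∈ U, F k z ≠ 0 := by
      refine Filter.Frequently.of_forall fun k => ?_
      intro z hz hFz
      have hck : (c k : ℂ) ≠ 0 := by exact_mod_cast (hcpos k).ne'
      have hP : (c k : ℂ) * Literature.NumberTheory.LFunctions.riemannXiUpper z +
          Literature.NumberTheory.LFunctions.riemannXiUpper (z + Complex.I) +
          Literature.NumberTheory.LFunctions.riemannXiUpper (z - Complex.I) = 0 := by
        have : (c k : ℂ) * F k z = 0 := by rw [hFz, mul_zero]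
        have h2 : (c k : ℂ) * F k z =
            (c k : ℂ) * Literature.NumberTheory.LFunctions.riemannXiUpper z + g z := by
          simp only [hF]; field_simp
        rw [h2] at this
        simpa [hg, add_assoc] using this
      exact hUim z hz (hreal k z hP)
    rcases Complex.hurwitz_eqOn_zero_or_forall_ne_zero hUopen hUconn hFdiff hlim hzero with h | h
    · have han : AnalyticOnNhd ℂ Literature.NumberTheory.LFunctions.riemannXiUpper Set.univ :=
        (hΞd.differentiableOn.analyticOnNhd isOpen_univ)
      have hev : ∀ᶠ z in nhds z₀, Literature.NumberTheory.LFunctions.riemannXiUpper z = 0 := by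
        filter_upwards [hUopen.mem_nhds hz₀U] with z hz using h hz
      have hall := han.eqOn_zero_of_preconnected_of_eventuallyEq_zero isPreconnected_univ
        (Set.mem_univ z₀) hev
      have := hall (Set.mem_univ (Complex.I / 2))
      rw [hΞval] at this
      norm_num at this
    · exact h z₀ hz₀U hz₀
  -- (2) the sequence of hyperbolic rungs c_k ≥ 4·2^k from base + doubling
  let S := {x : ℝ // 4 ≤ x ∧ Literature.NumberTheory.LFunctions.HasOnlyRealZeros
    (fun z : ℂ => (x : ℂ) * Literature.NumberTheory.LFunctions.riemannXiUpper z +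
      Literature.NumberTheory.LFunctions.riemannXiUpper (z + Complex.I) +
      Literature.NumberTheory.LFunctions.riemannXiUpper (z - Complex.I))}
  have step : ∀ s : S, ∃ s' : S, 2 * s.1 ≤ s'.1 := by
    rintro ⟨x, hx4, hx⟩
    obtain ⟨c', hc', hreal⟩ := hstep x hx4 hx
    exact ⟨⟨c', by linarith, hreal⟩, hc'⟩
  choose nxt hnxt using step
  have hbase' : Literature.NumberTheory.LFunctions.HasOnlyRealZeros
      (fun z : ℂ => ((4 : ℝ) : ℂ) * Literature.NumberTheory.LFunctions.riemannXiUpper z +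
        Literature.NumberTheory.LFunctions.riemannXiUpper (z + Complex.I) +
        Literature.NumberTheory.LFunctions.riemannXiUpper (z - Complex.I)) := by
    have hb := hbase
    unfold PencilBase at hb
    simpa using hb
  let s : ℕ → S := fun k => Nat.rec ⟨4, le_rfl, hbase'⟩ (fun _ t => nxt t) k
  have hs0 : (s 0).1 = 4 := rfl
  have hsucc : ∀ k, 2 * (s k).1 ≤ (s (k + 1)).1 := fun k => hnxt (s k)
  have hgrow : ∀ k, (4 : ℝ) * 2 ^ k ≤ (s k).1 := by
    intro k
    induction k with
    | zero => simp [hs0]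
    | succ k ih =>
      calc (4 : ℝ) * 2 ^ (k + 1) = 2 * (4 * 2 ^ k) := by ring
        _ ≤ 2 * (s k).1 := by linarith
        _ ≤ (s (k + 1)).1 := hsucc k
  have hΞ : Literature.NumberTheory.LFunctions.HasOnlyRealZeros
      Literature.NumberTheory.LFunctions.riemannXiUpper :=
    htransfer (fun k => (s k).1) hgrow (fun k => (s k).2.2)
  refine (_root_.Summit.RiemannHypothesis_iff).2 ?_
  exact (Literature.NumberTheory.LFunctions.riemannHypothesis_iff_im_eq_zero_of_riemannXiUpper_eq_zero_holds).2 hΞ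

end Summit.RiemannHypothesis.RiemannHypothesis.Theses.DisplacementPencil
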